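import Literature.Analysis.PDE.ConservationLawMollifier
import HarnessLib

/-!
# AxisTwistDoorAveragedConeLiouvilleNUGNSLip — Gagliardo–Nirenberg–Sobolev for compactly supported
# LIPSCHITZ functions on `ℝ³` (tool (t1) of the N4/T1 Lipschitz ports, plan `pub/ns-inputs/kits/N4-T1-plan.md` §3)

The Lipschitz twin of Mathlib's `MeasureTheory.eLpNorm_le_eLpNorm_fderiv_of_eq`: for `u : ℝ³ → ℝ`
`K`-Lipschitz with compact support, `1 ≤ p`, `p'⁻¹ = p⁻¹ − 3⁻¹`,
`‖u‖_{L^{p'}} ≤ C ‖Du‖_{L^p}` with the SAME constant `SNormLESNormFDerivOfEqConst ℝ volume p`; here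
`fderiv ℝ u` is the a.e. derivative (Rademacher).  Proof: mollify (`u_k = ρ̄_k ⋆ u` is `C¹` with compact
support, tree `Literature.Analysis.PDE.ConservationLaw.*`), apply Mathlib's inequality to each `u_k`, pass to
the limit: `‖Du_k‖_p → ‖Du‖_p` by dominated convergence (`Du_k → Du` a.e. from
`ae_tendsto_fderiv_mollify` on the three basis vectors, `‖Du_k‖ ≤ K`, common compact support), and
`‖u‖_{p'} ≤ liminf ‖u_k‖_{p'}` (`eLpNorm_lim_le_liminf_eLpNorm`, `u_k → u` pointwise).
An INPUT tool for the Lipschitz ports of the N–U De Giorgi chain; no NS-regularity statement is touched.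
[folklore]
-/

set_option linter.dupNamespace false

noncomputable section

open MeasureTheory Set Function Filter Topology Metric Module
open scoped NNReal ENNReal Convolution

namespace Summit.NavierStokesRegularity.NavierStokesRegularity.Theorems.AveragedConeLiouville.NU

open Literature.Analysis.PDE.ConservationLaw

/-- A continuous linear functional on `ℝ³` is the combination of the coordinate projections weighted by its
values on the standard basis vectors. [folklore] -/
theorem clm_eq_sum_smul_proj (L : EuclideanSpace ℝ (Fin 3) →L[ℝ] ℝ) :
    L = ∑ i, L (EuclideanSpace.single i 1) •
      (EuclideanSpace.proj i : EuclideanSpace ℝ (Fin 3) →L[ℝ] ℝ) := by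
  ext v
  have hv := (EuclideanSpace.basisFun (Fin 3) ℝ).sum_repr v
  simp only [EuclideanSpace.basisFun_repr, EuclideanSpace.basisFun_apply] at hv
  conv_lhs => rw [← hv]
  simp [map_sum, map_smul, mul_comm]

/-- Pointwise convergence of continuous linear functionals on `ℝ³` follows from convergence on the three
standard basis vectors. [folklore] -/
theorem tendsto_clm_of_tendsto_basis {L : ℕ → EuclideanSpace ℝ (Fin 3) →L[ℝ] ℝ}
    {L₀ : EuclideanSpace ℝ (Fin 3) →L[ℝ] ℝ}
    (h : ∀ i : Fin 3, Tendsto (fun k => L k (EuclideanSpace.single i 1)) atTop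
      (𝓝 (L₀ (EuclideanSpace.single i 1)))) :
    Tendsto L atTop (𝓝 L₀) := by
  have hL : L = fun k => ∑ i, L k (EuclideanSpace.single i 1) •
      (EuclideanSpace.proj i : EuclideanSpace ℝ (Fin 3) →L[ℝ] ℝ) :=
    funext fun k => clm_eq_sum_smul_proj (L k)
  rw [hL, clm_eq_sum_smul_proj L₀]
  exact tendsto_finsetSum _ fun i _ => (h i).smul_const _

/-- **GNS for compactly supported Lipschitz functions on `ℝ³`** (Lipschitz twin of Mathlib's
`eLpNorm_le_eLpNorm_fderiv_of_eq`, same constant): for `u : ℝ³ → ℝ` `K`-Lipschitz with compact support,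
`1 ≤ p` and `p'⁻¹ = p⁻¹ − (finrank ℝ ℝ³)⁻¹`,
`eLpNorm u p' ≤ SNormLESNormFDerivOfEqConst ℝ volume p * eLpNorm (fderiv ℝ u) p`
(`fderiv ℝ u` the a.e. derivative). [folklore] -/
theorem eLpNorm_le_eLpNorm_fderiv_of_eq_of_lipschitz
    {u : EuclideanSpace ℝ (Fin 3) → ℝ} {K : ℝ≥0} (hu : LipschitzWith K u) (h2u : HasCompactSupport u)
    {p p' : ℝ≥0} (hp : 1 ≤ p)
    (hp' : (p' : ℝ)⁻¹ = p⁻¹ - (Module.finrank ℝ (EuclideanSpace ℝ (Fin 3)) : ℝ)⁻¹) :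
    eLpNorm u p' volume ≤
      SNormLESNormFDerivOfEqConst ℝ (volume : Measure (EuclideanSpace ℝ (Fin 3))) p *
        eLpNorm (fderiv ℝ u) p volume := by
  obtain ⟨ρs, hr, hr2, hr1, -⟩ := exists_bumpSeq (V := EuclideanSpace ℝ (Fin 3))
  -- the mollified functions
  obtain ⟨uk, huk⟩ : ∃ uk : ℕ → EuclideanSpace ℝ (Fin 3) → ℝ,
      uk = fun k => (ρs k).normed volume ⋆[ContinuousLinearMap.lsmul ℝ ℝ, volume] u := ⟨_, rfl⟩
  have hloc : LocallyIntegrable u volume := hu.continuous.locallyIntegrable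
  have hC1 : ∀ k, ContDiff ℝ 1 (uk k) := fun k => by
    rw [huk]; exact contDiff_mollify (ρs k) hloc
  have hcs : ∀ k, HasCompactSupport (uk k) := fun k => by
    rw [huk]; exact hasCompactSupport_mollify (ρs k) h2u (hr1 k)
  have hn : 0 < Module.finrank ℝ (EuclideanSpace ℝ (Fin 3)) := by
    rw [finrank_euclideanSpace_fin]; norm_num
  have hGNS : ∀ k, eLpNorm (uk k) p' volume ≤
      SNormLESNormFDerivOfEqConst ℝ (volume : Measure (EuclideanSpace ℝ (Fin 3))) p *
        eLpNorm (fderiv ℝ (uk k)) p volume :=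
    fun k => eLpNorm_le_eLpNorm_fderiv_of_eq volume (hC1 k) (hcs k) hp hn hp'
  -- ### LHS: Fatou / lower semicontinuity of the `L^{p'}` seminorm
  have hmeas : ∀ k, AEStronglyMeasurable (uk k) volume := fun k =>
    (hC1 k).continuous.aestronglyMeasurable
  have hlim : ∀ᵐ x ∂(volume : Measure (EuclideanSpace ℝ (Fin 3))),
      Tendsto (fun k => uk k x) atTop (𝓝 (u x)) :=
    Eventually.of_forall fun x => by
      rw [huk]; exact tendsto_mollify_of_lipschitz hr hu x
  have hLHS : eLpNorm u p' volume ≤ liminf (fun k => eLpNorm (uk k) p' volume) atTop :=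
    MeasureTheory.Lp.eLpNorm_lim_le_liminf_eLpNorm hmeas u hlim
  -- ### RHS: dominated convergence for `∫ ‖D u_k‖^p`
  -- common compact support
  obtain ⟨S, hS⟩ : ∃ S : Set (EuclideanSpace ℝ (Fin 3)), S = cthickening 1 (tsupport u) := ⟨_, rfl⟩
  have hScpt : IsCompact S := by rw [hS]; exact h2u.isCompact.cthickening
  have hSmeas : MeasurableSet S := hScpt.isClosed.measurableSet
  have hsuppk : ∀ k, tsupport (uk k) ⊆ S := fun k => by
    rw [huk, hS]
    exact (tsupport_mollify_subset (ρs k) u).trans (cthickening_mono (hr1 k) _)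
  have hzero : ∀ k x, x ∉ S → fderiv ℝ (uk k) x = 0 := fun k x hx => by
    by_contra h
    exact hx (hsuppk k (support_fderiv_subset ℝ (Function.mem_support.2 h)))
  -- uniform bound `‖D u_k‖ ≤ K`
  have hbd : ∀ k x, ‖fderiv ℝ (uk k) x‖ ≤ K := fun k x => by
    refine ContinuousLinearMap.opNorm_le_bound _ K.coe_nonneg fun v => ?_
    rw [Real.norm_eq_abs, huk]
    exact abs_fderiv_mollify_le (ρs k) hu x v
  -- a.e. convergence of the derivatives
  have hDlim : ∀ᵐ x ∂(volume : Measure (EuclideanSpace ℝ (Fin 3))),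
      Tendsto (fun k => fderiv ℝ (uk k) x) atTop (𝓝 (fderiv ℝ u x)) := by
    have h3 : ∀ᵐ x ∂(volume : Measure (EuclideanSpace ℝ (Fin 3))), ∀ i : Fin 3,
        Tendsto (fun k => fderiv ℝ (uk k) x (EuclideanSpace.single i 1)) atTop
          (𝓝 (fderiv ℝ u x (EuclideanSpace.single i 1))) := by
      refine ae_all_iff.2 fun i => ?_
      have h := ae_tendsto_fderiv_mollify (μ := volume) hr hr2 hu (EuclideanSpace.single i 1)
      rw [huk]; exact h
    filter_upwards [h3] with x hx
    exact tendsto_clm_of_tendsto_basis hx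
  have hp0 : ((p : ℝ≥0∞)) ≠ 0 := by
    have : (0 : ℝ≥0) < p := zero_lt_one.trans_le hp
    exact_mod_cast this.ne'
  have hpR : 0 < (p : ℝ) := by exact_mod_cast zero_lt_one.trans_le hp
  have hRHS : Tendsto (fun k => eLpNorm (fderiv ℝ (uk k)) p volume) atTop
      (𝓝 (eLpNorm (fderiv ℝ u) p volume)) := by
    simp only [eLpNorm_eq_lintegral_rpow_enorm_toReal hp0 ENNReal.coe_ne_top, ENNReal.coe_toReal]
    refine ((ENNReal.continuous_rpow_const).tendsto _).comp ?_
    refine tendsto_lintegral_of_dominated_convergence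
      (S.indicator fun _ => ((K : ℝ≥0∞)) ^ (p : ℝ)) (fun k => ?_) (fun k => ?_) ?_ ?_
    · exact ((measurable_fderiv ℝ (uk k)).enorm.pow_const _)
    · refine Eventually.of_forall fun x => ?_
      beta_reduce
      by_cases hx : x ∈ S
      · rw [indicator_of_mem hx]
        refine ENNReal.rpow_le_rpow ?_ hpR.le
        have h1 : ‖fderiv ℝ (uk k) x‖₊ ≤ K := by
          rw [← NNReal.coe_le_coe, coe_nnnorm]; exact hbd k x
        rw [enorm_eq_nnnorm]
        exact_mod_cast h1
      · rw [indicator_of_notMem hx, hzero k x hx, enorm_eq_nnnorm, nnnorm_zero, ENNReal.coe_zero,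
          ENNReal.zero_rpow_of_pos hpR]
    · rw [lintegral_indicator_const hSmeas]
      exact ENNReal.mul_ne_top (ENNReal.rpow_ne_top_of_nonneg hpR.le ENNReal.coe_ne_top)
        hScpt.measure_lt_top.ne
    · filter_upwards [hDlim] with x hx
      exact ((ENNReal.continuous_rpow_const).tendsto _).comp
        ((continuous_enorm.tendsto _).comp hx)
  -- ### conclusion
  refine hLHS.trans ?_
  have h2 : Tendsto (fun k => SNormLESNormFDerivOfEqConst ℝ (volume : Measure (EuclideanSpace ℝ (Fin 3))) p *
      eLpNorm (fderiv ℝ (uk k)) p volume) atTop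
      (𝓝 (SNormLESNormFDerivOfEqConst ℝ (volume : Measure (EuclideanSpace ℝ (Fin 3))) p *
        eLpNorm (fderiv ℝ u) p volume)) :=
    ENNReal.Tendsto.const_mul hRHS (Or.inr ENNReal.coe_ne_top)
  rw [← h2.liminf_eq]
  exact liminf_le_liminf (Eventually.of_forall hGNS)

end Summit.NavierStokesRegularity.NavierStokesRegularity.Theorems.AveragedConeLiouville.NU
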